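import Summits.CriticalPhenomena.PercolationContinuityZ3.Theorems.Transplant.FKThreeApexUCondRimStep
import Summits.CriticalPhenomena.PercolationContinuityZ3.Theorems.Transplant.FKDoubleFanNegCorrRim
import Summits.CriticalPhenomena.PercolationContinuityZ3.Theorems.Transplant.FKDoubleFanNegCorrAxis
import HarnessLib

/-!
# Double fans `K₂ ∨ P_{m+1}`: THE AXIS AND A RIM EDGE are negatively correlated (`0 < q ≤ 1`) — the first "generalized T5" pair

Support file (`--supports stmt-CriticalPhenomena-4575`), FK sub-lane `prim-bschramm-fk-3` (gen 25); builds on p205010 (kernel theorem, internal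
audit signed; external expert review pending).  No named facts, no sorries; standard axioms.  Memo `bschramm/prim-bschramm-fk-3/U-RIM.md` §3.

Pinning the axis `ab` (`τ`) and the rim edge `c_j c_{j+1}` (`β`) and cutting the word at block `j+1` gives the four valuations
`axisRimZ q u s τ β = val(s ∗ edgeAB(τ) ∗ E_β u)` with `u = Z_j(w[ab ↦ 0])`, `s = restVec_{j+1} ∗ edgeAC ∗ edgeBC`, both in `InKE q`
(`cut_pin_axis_rim`; the axis letter commutes with everything, `…DoubleFanNegCorrAxis`).  The Rayleigh difference is (`rayleigh_axisRim_eq`)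
`q²(1−q)·G(u,s)` with — writing `t = qZ_0 + qZ_ab + Z_ac + Z_bc + Z_1` and `c = qZ_0 + Z_ac + Z_bc` for the two masses of `detach` —
`G(u,s) = c_u c_s t(u∗s) − t_u t_s c(u∗s)` (gen 21, memo `RIM-PAIRS.md` Finding A: supermultiplicativity of `t/c`), and the NEW EXACT IDENTITY
  `G(u,s) = t_u · (u_ac N^{(bc)}(s) + u_bc N^{(ac)}(s)) − (1−q) · I_c(u) · M_c(s)`,  `I_c(u) = u_0u_1 − u_ab(u_ac+u_bc) = −J_c(u)`,
i.e. `axisRimForm`.  It is `≥ 0` as soon as BOTH `u` and `s` satisfy the upper-envelope condition `(U_c)` (`axisRimForm_nonneg`): `(U_c)(u)` at the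
probe `(√N^{(ac)}(s), √N^{(bc)}(s))` gives `t_u(u_bc N^{(ac)}_s + u_ac N^{(bc)}_s) ≥ (1−q) I_c(u) (√N^{(ac)}_s + √N^{(bc)}_s)²`, and `(U_c)(s)`
gives `(√N^{(ac)}_s + √N^{(bc)}_s)² ≥ M_c(s)`.  Since `U_c` holds on `InKE` (`InKE.uCondC`, `…ThreeApexUCondRimStep`), every weighted double fan
satisfies **`negCorr_axis_rim`**: `φ(J_{c_j c_{j+1}} ∩ J_{ab}) ≤ φ(J_{c_j c_{j+1}}) φ(J_{ab})` (`0 < q ≤ 1`, all `j + 1 ≤ m`).  It is false with the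
`Valid` package alone (gen 21: `G < 0` on ≈0.1% of `Valid²`).
[cite: Grimmett2006, §3.9 eq. (3.94) (pp. 63–64); §1.4 eq. (1.20) (p. 15)] [folklore]
-/

noncomputable section

namespace Summit.CriticalPhenomena.PercolationContinuityZ3.Theorems

namespace FK

namespace ThreeApex

/-! ### The algebra: four valuations, the closed form, positivity from `(U_c)` -/

/-- The four pinned valuations of (axis `τ`, rim edge `β`): `val(s ∗ edgeAB(τ) ∗ E_β u)`. [folklore] -/
def axisRimZ (q : ℝ) (u s : V5) (τ β : ℝ) : ℝ := val q (conv s (conv (edgeAB τ) (rimStep q β u)))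

/-- The axis–rim Rayleigh form `G(u,s) = t_u(u_ac N^{(bc)}(s) + u_bc N^{(ac)}(s)) + (1−q) J_c(u) M_c(s)`, written with the apex-`c` images
(`swapAC`) of the apex-`a` quantities `W`, `J_a`, `M_a`. [folklore] -/
def axisRimForm (q : ℝ) (u s : V5) : ℝ :=
  wlin q (swapAC u) * (u.zac * masterN q (swapAB s) + u.zbc * masterN q s) + (1 - q) * jA (swapAC u) * massA q (swapAC s)

/-- **Axis–rim Rayleigh identity**: `Z¹⁰Z⁰¹ − Z¹¹Z⁰⁰ = q²(1−q)·G(u,s)` (first index: axis pin, second: rim pin). [folklore] -/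
theorem rayleigh_axisRim_eq (q : ℝ) (u s : V5) :
    axisRimZ q u s 1 0 * axisRimZ q u s 0 1 - axisRimZ q u s 1 1 * axisRimZ q u s 0 0 = q ^ 2 * (1 - q) * axisRimForm q u s := by
  simp only [axisRimZ, axisRimForm, val, conv, edgeAB, rimStep, wlin, masterN, massA, swapAB, swapAC, jA, hx, hy, hz, V5.total]
  ring

/-- `G(u,s) = c_u c_s t(u∗s) − t_u t_s c(u∗s)`: the supermultiplicativity form of gen 21 (`t`, `c` the masses of `detach`). [folklore] -/
theorem axisRimForm_eq_detach (q : ℝ) (u s : V5) :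
    axisRimForm q u s = (detach q u).z0 * (detach q s).z0 * (detach q (conv u s)).total
      - (detach q u).total * (detach q s).total * (detach q (conv u s)).z0 := by
  simp only [axisRimForm, detach, conv, wlin, masterN, massA, swapAB, swapAC, jA, hx, hy, hz, V5.total]; ring

/-- `N^{(ab)}` of the `a ↔ c` image is `N^{(bc)}`. [folklore] -/
theorem masterNab_swapAC (q : ℝ) (s : V5) : masterN q (swapBC (swapAC s)) = masterN q (swapAB s) := by
  simp only [masterN, swapBC, swapAC, swapAB]; ring

/-- `N^{(ac)}` is invariant under `a ↔ c`. [folklore] -/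
theorem masterN_swapAC (q : ℝ) (s : V5) : masterN q (swapAC s) = masterN q s := by
  simp only [masterN, swapAC]; ring

/-- **Positivity of the axis–rim form** from `(U_c)` on both sides (masses `≥ 0`, `0 < q ≤ 1`). [folklore] -/
theorem axisRimForm_nonneg {q : ℝ} (hq0 : 0 < q) (hq1 : q ≤ 1) {u s : V5} (hu : u.Nonneg) (hs : s.Nonneg)
    (hUu : UCond q (swapAC u)) (hUs : UCond q (swapAC s)) : 0 ≤ axisRimForm q u s := by
  have hq' : 0 ≤ 1 - q := sub_nonneg.2 hq1
  obtain ⟨hu0, hu1, hu2, hu3, hu4⟩ := hu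
  obtain ⟨hs0, hs1, hs2, hs3, hs4⟩ := hs
  -- the two master forms of `s` and their square roots
  have Hs := H5.quad_copos_iff_aux (α := masterN q (swapBC (swapAC s))) (β := masterN q (swapAC s)) (γ := (2 - q) * jA (swapAC s))
    (fun w₁ w₂ hw₁ hw₂ => by rw [← uForm_eq]; exact hUs w₁ w₂ hw₁ hw₂)
  have hNbc : 0 ≤ masterN q (swapAB s) := by rw [← masterNab_swapAC]; exact Hs.1
  have hNac : 0 ≤ masterN q s := by rw [← masterN_swapAC]; exact Hs.2.1
  set α := Real.sqrt (masterN q (swapAB s)) with hαdef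
  set β := Real.sqrt (masterN q s) with hβdef
  have hα : 0 ≤ α := Real.sqrt_nonneg _
  have hβ : 0 ≤ β := Real.sqrt_nonneg _
  have hα2 : α ^ 2 = masterN q (swapAB s) := Real.sq_sqrt hNbc
  have hβ2 : β ^ 2 = masterN q s := Real.sq_sqrt hNac
  -- `(α+β)² ≥ M_c(s)`
  have hM : massA q (swapAC s) ≤ (α + β) ^ 2 := by
    have e := masterN_add_sub_massA q (swapAC s)
    rw [masterNab_swapAC, masterN_swapAC, ← hα2, ← hβ2] at e
    -- `α² + β² − M = (2−q) J`, need `(2−q)J + 2αβ ≥ 0`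
    have hJ2 : 0 ≤ (2 - q) * jA (swapAC s) + 2 * α * β := by
      rcases hUs.disc hq1 with hJ | hD
      · have : 0 ≤ 2 - q := by linarith
        positivity
      · rw [discU_eq_masterN, masterNab_swapAC, masterN_swapAC, ← hα2, ← hβ2] at hD
        have hsq : ((2 - q) * jA (swapAC s)) ^ 2 ≤ (2 * α * β) ^ 2 := by nlinarith
        have hab' : 0 ≤ 2 * α * β := by positivity
        nlinarith [abs_le_of_sq_le_sq' hsq hab']
    nlinarith
  have hMnn : 0 ≤ massA q (swapAC s) := by simp only [massA, swapAC]; positivity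
  have hW : 0 ≤ wlin q (swapAC u) := by simp only [wlin, swapAC]; positivity
  -- `(U_c)(u)` at the probe `(β, α)`
  have h1 := hUu β α hβ hα
  rw [uForm_eq_wlin] at h1
  simp only [swapAC] at h1 hW ⊢
  simp only [axisRimForm, swapAC]
  rw [hα2, hβ2] at h1
  by_cases hJ : 0 ≤ jA ⟨u.z0, u.zbc, u.zac, u.zab, u.z1⟩
  · have : 0 ≤ u.zac * masterN q (swapAB s) + u.zbc * masterN q s := by positivity
    positivity
  · have hI : 0 < -jA ⟨u.z0, u.zbc, u.zac, u.zab, u.z1⟩ := by linarith [lt_of_not_ge hJ]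
    -- from h1: W (β² u_bc + α² u_ac) ≥ I ((1−q)(α+β)² + q β α) ≥ (1−q) I (α+β)² ≥ (1−q) I M
    have h2 : (1 - q) * (-jA ⟨u.z0, u.zbc, u.zac, u.zab, u.z1⟩) * massA q ⟨s.z0, s.zbc, s.zac, s.zab, s.z1⟩ ≤
        (1 - q) * (-jA ⟨u.z0, u.zbc, u.zac, u.zab, u.z1⟩) * (β + α) ^ 2 := by
      have : (β + α) ^ 2 = (α + β) ^ 2 := by ring
      rw [this]
      exact mul_le_mul_of_nonneg_left hM (by positivity)
    have h3 : 0 ≤ q * β * α := by positivity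
    nlinarith [h1, h2, h3, mul_nonneg (mul_nonneg hI.le h3) le_rfl]

/-- **The axis–rim Rayleigh difference is `≥ 0` on `InKE × InKE`** (`0 < q ≤ 1`). [folklore] -/
theorem InKE.rayleigh_axisRim_nonneg {q : ℝ} (hq0 : 0 < q) (hq1 : q ≤ 1) {u s : V5} (hu : InKE q u) (hs : InKE q s) :
    0 ≤ axisRimZ q u s 1 0 * axisRimZ q u s 0 1 - axisRimZ q u s 1 1 * axisRimZ q u s 0 0 := by
  rw [rayleigh_axisRim_eq]
  have hq' : 0 ≤ 1 - q := sub_nonneg.2 hq1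
  have hG := axisRimForm_nonneg hq0 hq1 (hu.valid hq0.le hq1).nonneg (hs.valid hq0.le hq1).nonneg (hu.uCondC hq0 hq1) (hs.uCondC hq0 hq1)
  positivity

/-! ### The measure-level statement -/

open MeasureTheory Literature.Probability.LatticeModels Literature.Probability.Percolation
open scoped Classical

variable {V : Type*} [Fintype V]

section Setting

variable {a b : V} {c : ℕ → V} {m : ℕ}
variable (hab : a ≠ b) (hinj : ∀ j k, j ≤ m → k ≤ m → c j = c k → j = k) (hca : ∀ j, j ≤ m → c j ≠ a) (hcb : ∀ j, j ≤ m → c j ≠ b)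
include hab hinj hca hcb

omit [Fintype V] in
/-- **The word with the rim edge `c_j c_{j+1}` and the axis pinned**, through the cut at block `j+1`:
`axisRimZ q Z_j(w[ab ↦ 0]) (restVec_{j+1} ∗ edgeAC ∗ edgeBC) τ β`. [folklore] -/
theorem cut_pin_axis_rim (q : ℝ) (w : Sym2 V → unitInterval) {j : ℕ} (hj : j + 1 ≤ m) (β τ : unitInterval) :
    transferDF q (Function.update (Function.update w s(c j, c (j + 1)) β) s(a, b) τ) a b c m =
      axisRimZ q (zDF q (Function.update w s(a, b) 0) a b c j)
        (conv (restVec q w a b c (j + 1) (m - (j + 1)))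
          (conv (edgeAC (wR w s(a, c (j + 1)))) (edgeBC (wR w s(b, c (j + 1)))))) (τ : ℝ) (β : ℝ) := by
  set w₁ := Function.update w s(c j, c (j + 1)) β with hw₁
  set w₂ := Function.update w₁ s(a, b) τ with hw₂
  have hj0 : j ≤ m := by omega
  have hlater1 : ∀ k, j + 1 < k → k ≤ m → ¬ ReadsAt a b c k s(c j, c (j + 1)) := fun k hk hkm hr =>
    absurd ((readsAt_rim_iff hinj hca hcb hj hkm).1 hr) (by omega)
  have hlater2 : ∀ k, j + 1 < k → k ≤ m → ¬ ReadsAt a b c k s(a, b) := fun k hk hkm hr =>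
    absurd ((readsAt_axis_iff hab hca hcb hkm).1 hr) (by omega)
  have hrest : restVec q w₂ a b c (j + 1) (m - (j + 1)) = restVec q w a b c (j + 1) (m - (j + 1)) := by
    rw [hw₂, restVec_update_eq q w₁ τ (m - (j + 1)) (j + 1) (by omega) hlater2, hw₁,
      restVec_update_eq q w β (m - (j + 1)) (j + 1) (by omega) hlater1]
  -- axis factorization at block `j`
  have hfac := zDF_axis_factor hab hca hcb q w₁ τ j hj0
  have hzero : zDF q (Function.update w₁ s(a, b) 0) a b c j = zDF q (Function.update w s(a, b) 0) a b c j := by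
    rw [hw₁, Function.update_comm (rim_ne_axis hca hj)]
    exact zDF_update_eq_of_not_reads q (Function.update w s(a, b) 0) β j
      (fun k hk hr => absurd ((readsAt_rim_iff hinj hca hcb hj (by omega)).1 hr) (by omega))
  have hβ : wR w₂ s(c j, c (j + 1)) = (β : ℝ) := by
    rw [hw₂, wR_update_of_ne w₁ (rim_ne_axis hca hj), hw₁, wR_update_self]
  have hx : wR w₂ s(a, c (j + 1)) = wR w s(a, c (j + 1)) := by
    rw [hw₂, wR_update_of_ne w₁ (spokeA_ne_axis hab hcb hj), hw₁, wR_update_of_ne w (spokeA_ne_rim hca (j := j + 1) hj)]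
  have hy : wR w₂ s(b, c (j + 1)) = wR w s(b, c (j + 1)) := by
    rw [hw₂, wR_update_of_ne w₁ (spokeB_ne_axis hab hca hj), hw₁, wR_update_of_ne w (spokeB_ne_rim hcb (j := j + 1) hj)]
  rw [transferDF_eq_cut q w₂ a b c hj, zDF_eq_block, hrest, blockIn_succ, hβ, hx, hy, hw₂, hfac, hzero, rimStep_conv_edgeAB]
  -- reassociate: s' ∗ (AC x ∗ (BC y ∗ (AB τ ∗ E u))) = (s' ∗ (AC x ∗ BC y)) ∗ (AB τ ∗ E u)
  simp only [axisRimZ, ← mul_def]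
  simp only [mul_assoc]

/-- **THE AXIS AND A RIM EDGE ARE NEGATIVELY CORRELATED** in every weighted double fan `K₂ ∨ P_{m+1}` (`0 < q ≤ 1`, `card V = m + 3`,
`w` supported on the double fan), for every `j + 1 ≤ m`: `φ(J_{c_j c_{j+1}} ∩ J_{ab}) ≤ φ(J_{c_j c_{j+1}}) φ(J_{ab})`. [cite: Grimmett2006, §3.9 eq. (3.94) (pp. 63–64)] -/
theorem negCorr_axis_rim (hcard : Fintype.card V = m + 3) {q : ℝ} (hq0 : 0 < q) (hq1 : q ≤ 1) (w : Sym2 V → unitInterval)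
    (hsupp : ∀ e, e ∉ dfPairs a b c m → w e = 0) {j : ℕ} (hj : j + 1 ≤ m) :
    (rcMeasureW w q ∅).real ({ω : BondConfig V | s(c j, c (j + 1)) ∈ ω} ∩ {ω | s(a, b) ∈ ω}) ≤
      (rcMeasureW w q ∅).real {ω : BondConfig V | s(c j, c (j + 1)) ∈ ω} *
        (rcMeasureW w q ∅).real {ω : BondConfig V | s(a, b) ∈ ω} := by
  have he : s(c j, c (j + 1)) ∈ dfPairs a b c m := (mem_dfPairs_iff a b c m _).2 (Or.inr (Or.inr ⟨j, hj, rfl⟩))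
  have hf : s(a, b) ∈ dfPairs a b c m := (mem_dfPairs_iff a b c m _).2 (Or.inl rfl)
  have hne : s(a, b) ≠ s(c j, c (j + 1)) := (rim_ne_axis hca hj).symm
  set u := zDF q (Function.update w s(a, b) 0) a b c j with hu
  set s := conv (restVec q w a b c (j + 1) (m - (j + 1)))
    (conv (edgeAC (wR w s(a, c (j + 1)))) (edgeBC (wR w s(b, c (j + 1))))) with hs
  have hZ : ∀ β τ : unitInterval, rcPartitionFunctionW (Function.update (Function.update w s(c j, c (j + 1)) β) s(a, b) τ) q ∅ =
      axisRimZ q u s (τ : ℝ) (β : ℝ) := by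
    intro β τ
    rw [rcPartitionFunctionW_eq_transferDF hab hinj hca hcb hcard q _
      (supp_update_dfPair _ (supp_update_dfPair w hsupp he β) hf τ),
      cut_pin_axis_rim hab hinj hca hcb q w hj β τ]
  have huK : InKE q u := inKE_zDF q (Function.update w s(a, b) 0) a b c j
  have hsK : InKE q s := InKE.mul (inKE_restVec q w a b c (m - (j + 1)) (j + 1))
    (InKE.step (IsLetter.ac (w _).2.1 (w _).2.2) (by
      rw [← mul_one (edgeBC (wR w s(b, c (j + 1)))), mul_def, one_def]
      exact InKE.step (IsLetter.bc (w _).2.1 (w _).2.2) InKE.base))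
  have key := InKE.rayleigh_axisRim_nonneg hq0 hq1 huK hsK
  refine negCorr_of_pinned_rayleigh w hq0 hne ?_
  rw [hZ 1 1, hZ 0 0, hZ 1 0, hZ 0 1]
  simp only [Set.Icc.coe_one, Set.Icc.coe_zero]
  linarith [key]

end Setting

end ThreeApex

end FK

end Summit.CriticalPhenomena.PercolationContinuityZ3.Theorems
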